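import Summits.RiemannHypothesis.RiemannHypothesis.Theorems.PfPersistenceDilatingLandauThetaLittlewood
import Summits.RiemannHypothesis.RiemannHypothesis.Theorems.PfPersistenceDilatingLandauWeightedConverse
import Summits.RiemannHypothesis.RiemannHypothesis.Theorems.PfPersistenceDilatingLandauWeightedLittlewood
import Summits.RiemannHypothesis.RiemannHypothesis.Theorems.PfPersistenceHalfLineBiasConverse
import Summits.RiemannHypothesis.RiemannHypothesis.Theorems.PfPersistenceHalfLineBiasSuzuki
import HarnessLib

/-!
# LANDAU — the table of record for the dilating `Λ`-family `{ψ, θ, S, B}`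

Cell `pub-rhpf` (mechanism/rigidity campaign; **no RH claims**), CAND SEAT 7 gen 8, CASE-DAG v6 §6
kernel target LANDAU: one citable declaration per face collecting, from the files of this series,
the words of the ONE-SIDED READER TABLE for the four dilating statistics

* `ψ(x) − x` (threshold scale `x^{1/2}`), `θ(x) − x` (same), `S(x) − 2√x` with
  `S(x) = Σ_{n ≤ x} Λ(n)/√n` (threshold scale `x^0`), and the half-line bias
  `B(x) = ∫_1^x S(u) du/u − 4√x` (threshold scale `x^0`):

(U) at the threshold scale the one-sided reader is FALSE for `ζ` (both sides for `ψ`, `θ`, `S`; lower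
side for `B`) or EQUIVALENT to RH (upper side of `B`: Suzuki 2024); (E) for every `ε > 0` the
one-sided `x^{threshold+ε}` reader, either side, is EQUIVALENT to RH; (Q) above the threshold a
one-sided `x^σ` reader implies quasi-RH(`σ` resp. `1/2 + σ`) (files I/III of each face). So no member
of the family yields an RH-free-and-sound one-sided certificate: `landau_table`.

No new mathematics in this file (conjunction of landed theorems); sorry-free; `RiemannHypothesis`
occurs only inside the quoted `↔`/`→` statements.

References: [MontgomeryVaughan2007] Montgomery–Vaughan, *Multiplicative Number Theory I*, Thm. 13.1,
Thm. 15.3, Thm. 15.11; [Suzuki2024] M. Suzuki, Thm. 1; [Suzuki2023] M. Suzuki, Thm. 1.7.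
-/

noncomputable section

-- the sub-problem path RiemannHypothesis/RiemannHypothesis duplicates a namespace (D-0017)
set_option linter.dupNamespace false

open Filter Topology Asymptotics
open scoped Chebyshev

namespace Summit.RiemannHypothesis.RiemannHypothesis.Theorems.PfPersistenceDilatingLandauTable

open Literature.NumberTheory.LFunctions
open Summit.RiemannHypothesis.RiemannHypothesis.Theorems.PfPersistenceDilatingLandau
open Summit.RiemannHypothesis.RiemannHypothesis.Theorems.PfPersistenceDilatingLandauTheta
open Summit.RiemannHypothesis.RiemannHypothesis.Theorems.PfPersistenceDilatingLandauThetaLittlewood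
open Summit.RiemannHypothesis.RiemannHypothesis.Theorems.PfPersistenceDilatingLandauWeightedMellin
open Summit.RiemannHypothesis.RiemannHypothesis.Theorems.PfPersistenceDilatingLandauWeightedConverse
open Summit.RiemannHypothesis.RiemannHypothesis.Theorems.PfPersistenceDilatingLandauWeightedLittlewood
open Summit.RiemannHypothesis.RiemannHypothesis.Theorems.PfPersistenceHalfLineBiasMellin
open Summit.RiemannHypothesis.RiemannHypothesis.Theorems.PfPersistenceHalfLineBiasConverse
open Summit.RiemannHypothesis.RiemannHypothesis.Theorems.PfPersistenceHalfLineBiasSuzuki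

/-- **`ψ`-face:** (U) both one-sided `A√x` readers of `ψ(x) − x` fail for `ζ` (Littlewood);
(E) RH ⟺ the upper, and ⟺ the lower, `x^{1/2+ε}`-∀ε reader. [cite: MontgomeryVaughan2007, Thm. 15.11, Thm. 15.3, Thm. 13.1] -/
theorem psi_face :
    (∀ A σ : ℝ, σ ≤ 1 / 2 → (¬ ∀ᶠ x in atTop, ψ x - x ≤ A * x ^ σ) ∧
        ¬ ∀ᶠ x in atTop, -(A * x ^ σ) ≤ ψ x - x) ∧
      (RiemannHypothesis ↔ ∀ ε : ℝ, 0 < ε → ∀ᶠ x in atTop, ψ x - x ≤ x ^ (1 / 2 + ε)) ∧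
      (RiemannHypothesis ↔ ∀ ε : ℝ, 0 < ε → ∀ᶠ x in atTop, -(x ^ (1 / 2 + ε)) ≤ ψ x - x) :=
  ⟨fun A _ hσ ↦ ⟨not_eventually_psi_sub_le_mul_rpow_of_le_half A hσ,
      not_eventually_neg_mul_rpow_le_psi_sub_of_le_half A hσ⟩,
    riemannHypothesis_iff_psi_upper_eps, riemannHypothesis_iff_psi_lower_eps⟩

/-- **`θ`-face:** (U) both one-sided `A√x` readers of `θ(x) − x` fail for `ζ`, in particular the prime
deficit `θ(x) ≤ x` fails infinitely often although it would imply RH; (E) RH ⟺ either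
`x^{1/2+ε}`-∀ε reader. [cite: MontgomeryVaughan2007, Thm. 15.11, Thm. 15.3, Thm. 13.1] -/
theorem theta_face :
    (∀ A σ : ℝ, σ ≤ 1 / 2 → (¬ ∀ᶠ x in atTop, θ x - x ≤ A * x ^ σ) ∧
        ¬ ∀ᶠ x in atTop, -(A * x ^ σ) ≤ θ x - x) ∧
      ((¬ ∀ᶠ x in atTop, θ x ≤ x) ∧ ((∀ᶠ x in atTop, θ x ≤ x) → RiemannHypothesis)) ∧
      (RiemannHypothesis ↔ ∀ ε : ℝ, 0 < ε → ∀ᶠ x in atTop, θ x - x ≤ x ^ (1 / 2 + ε)) ∧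
      (RiemannHypothesis ↔ ∀ ε : ℝ, 0 < ε → ∀ᶠ x in atTop, -(x ^ (1 / 2 + ε)) ≤ θ x - x) :=
  ⟨fun A _ hσ ↦ ⟨not_eventually_theta_sub_le_mul_rpow_of_le_half A hσ,
      not_eventually_theta_lower_of_le_half A hσ⟩,
    ⟨not_eventually_theta_le_self, riemannHypothesis_of_theta_le_self⟩,
    riemannHypothesis_iff_theta_upper_eps, riemannHypothesis_iff_theta_lower_eps⟩

/-- **`S`-face** (`S(x) = Σ_{n ≤ x} Λ(n)/√n`, `wpsiErr x = S(x) − 2√x`): (U) both one-sided `O(1)`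
readers fail for `ζ` although each would imply RH; (E) RH ⟺ either `x^ε`-∀ε reader ⟺
`S(x) − 2√x = O(log² x)`. [cite: MontgomeryVaughan2007, Thm. 15.11, Thm. 15.3, Thm. 13.1] -/
theorem weighted_face :
    (∀ A : ℝ, (¬ ∀ᶠ x in atTop, wpsi x ≤ 2 * x ^ (1 / 2 : ℝ) + A) ∧
        (¬ ∀ᶠ x in atTop, 2 * x ^ (1 / 2 : ℝ) - A ≤ wpsi x) ∧
        ((∀ᶠ x in atTop, wpsi x ≤ 2 * x ^ (1 / 2 : ℝ) + A) → RiemannHypothesis) ∧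
        ((∀ᶠ x in atTop, 2 * x ^ (1 / 2 : ℝ) - A ≤ wpsi x) → RiemannHypothesis)) ∧
      (RiemannHypothesis ↔ ∀ ε : ℝ, 0 < ε → ∀ᶠ x in atTop, wpsiErr x ≤ x ^ ε) ∧
      (RiemannHypothesis ↔ ∀ ε : ℝ, 0 < ε → ∀ᶠ x in atTop, -x ^ ε ≤ wpsiErr x) ∧
      (RiemannHypothesis ↔ wpsiErr =O[atTop] fun x ↦ Real.log x ^ 2) :=
  ⟨wpsi_bdd_readers, riemannHypothesis_iff_wpsi_upper_eps, riemannHypothesis_iff_wpsi_lower_eps,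
    riemannHypothesis_iff_wpsiErr_isBigO_log_sq⟩

/-- **`B`-face** (half-line bias `hlb x = B(x)`, Suzuki's `chebyshevHalfLineBias` for `x > 0`, and the
screw function `Ψ`): (U) the lower `O(1)` reader fails for `ζ` (unconditionally `lim inf B = −∞`),
the upper `O(1)` reader is EQUIVALENT to RH (Suzuki 2024, Thm. 1, discharged), as are
`Ψ` eventually bounded above / below; (E) RH ⟺ either `x^ε`-∀ε reader.
[cite: Suzuki2024, Thm. 1; Suzuki2023, Thm. 1.7; MontgomeryVaughan2007, Thm. 15.3, Thm. 13.1] -/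
theorem bias_face :
    ((∀ A : ℝ, ¬ ∀ᶠ x in atTop, -A ≤ hlb x) ∧
        ∀ A : ℝ, ((∀ᶠ x in atTop, hlb x ≤ A) ↔ RiemannHypothesis)) ∧
      (RiemannHypothesis ↔ ∀ᶠ x in atTop, chebyshevHalfLineBias x ≤ 0) ∧
      (RiemannHypothesis ↔ ∀ ε : ℝ, 0 < ε → ∀ᶠ x in atTop, hlb x ≤ x ^ ε) ∧
      (RiemannHypothesis ↔ ∀ ε : ℝ, 0 < ε → ∀ᶠ x in atTop, -x ^ ε ≤ hlb x) ∧
      (RiemannHypothesis ↔ ∃ M : ℝ, ∀ᶠ t in atTop, -M ≤ zetaScrew t) ∧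
      (RiemannHypothesis ↔ ∃ A : ℝ, ∀ᶠ t in atTop, zetaScrew t ≤ A) :=
  ⟨hlb_bdd_readers, riemannHypothesis_iff_chebyshevHalfLineBias_eventually_nonpos,
    riemannHypothesis_iff_hlb_upper_eps, riemannHypothesis_iff_hlb_lower_eps,
    zetaScrew_readers.1, zetaScrew_readers.2.1⟩

/-- **LANDAU, table of record** for the dilating `Λ`-family `{ψ, θ, S, B}`: the four faces together.
Every one-sided power-scale reader of every member is RH-graded — false or RH-equivalent at its
threshold scale, RH-equivalent at the `∀ε` scale — hence never an RH-free certificate.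
[cite: MontgomeryVaughan2007, Thm. 13.1, Thm. 15.3, Thm. 15.11; Suzuki2024, Thm. 1] -/
theorem landau_table :
    ((∀ A σ : ℝ, σ ≤ 1 / 2 → (¬ ∀ᶠ x in atTop, ψ x - x ≤ A * x ^ σ) ∧
        ¬ ∀ᶠ x in atTop, -(A * x ^ σ) ≤ ψ x - x) ∧
      (RiemannHypothesis ↔ ∀ ε : ℝ, 0 < ε → ∀ᶠ x in atTop, ψ x - x ≤ x ^ (1 / 2 + ε))) ∧
    ((∀ A σ : ℝ, σ ≤ 1 / 2 → (¬ ∀ᶠ x in atTop, θ x - x ≤ A * x ^ σ) ∧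
        ¬ ∀ᶠ x in atTop, -(A * x ^ σ) ≤ θ x - x) ∧
      (RiemannHypothesis ↔ ∀ ε : ℝ, 0 < ε → ∀ᶠ x in atTop, θ x - x ≤ x ^ (1 / 2 + ε))) ∧
    ((∀ A : ℝ, (¬ ∀ᶠ x in atTop, wpsi x ≤ 2 * x ^ (1 / 2 : ℝ) + A) ∧
        ¬ ∀ᶠ x in atTop, 2 * x ^ (1 / 2 : ℝ) - A ≤ wpsi x) ∧
      (RiemannHypothesis ↔ wpsiErr =O[atTop] fun x ↦ Real.log x ^ 2)) ∧
    ((∀ A : ℝ, ¬ ∀ᶠ x in atTop, -A ≤ hlb x) ∧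
      (∀ A : ℝ, ((∀ᶠ x in atTop, hlb x ≤ A) ↔ RiemannHypothesis)) ∧
      (RiemannHypothesis ↔ ∃ A : ℝ, ∀ᶠ t in atTop, zetaScrew t ≤ A)) :=
  ⟨⟨psi_face.1, psi_face.2.1⟩, ⟨theta_face.1, theta_face.2.2.1⟩,
    ⟨fun A ↦ ⟨(weighted_face.1 A).1, (weighted_face.1 A).2.1⟩, weighted_face.2.2.2⟩,
    ⟨bias_face.1.1, bias_face.1.2, bias_face.2.2.2.2.2⟩⟩

end Summit.RiemannHypothesis.RiemannHypothesis.Theorems.PfPersistenceDilatingLandauTable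

end
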